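import Summits.FinalStateConjecture.FinalStateConjecture.Theorems.PhotonSphereChannelsTameHullDefs
import HarnessLib

/-!
# Route PhotonSphereChannels · crux `ChannelsResolveTameDevelopmentsR` (K2R, stmt-FinalStateConjecture-14075) — posited
# objects of the line `kerr-isolation-dichotomy` (route-posited definitions, D-0016 `<Route>Defs` convention)

This file carries no mathematics beyond definitions and two projection lemmas. It is the NEW vocabulary (§1b of the skeleton
`Cruxes/ChannelsResolveTameDevelopmentsR/Lines/kerr_isolation_dichotomy.lean`, planner
planner-cruxplan-stmt-FinalStateConjecture-14075-kerr-isolation-dicho-0; lead prover-line-stmt-FinalStateConjecture-14075-1)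
over which the six registered stubs of that line are stated, moved verbatim out of the crux workfile so that stub proofs can be
landed as `Theorems/…` files (`--supports stmt-FinalStateConjecture-14075`) importing it; it extends the landed hull interface
`PhotonSphereChannelsTameHullDefs.lean` (namespace `…Theorems.TameHull`: `EndDatum`, `IsTameEnd`, `IsHullElement`, …):

* `EndDatum.IsSilent` — two-sided non-radiating ∧ silent horizon ∧ (red-shifted ∨ cold) (the bundled output of the budgets);
* `EndDatum.IsGloballyClose`, `EndDatum.IsGloballyFlat` — ONE chart of the whole Kerr exterior (resp. of `E4`) onto the
  d.o.c. with `C²` sup deviation `≤ δ` (the GLOBAL topology in which isolation is claimed);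
* `kerrWindow`, `IsWindowChart`, `anchoredDev`, `kerrDev` — the anchored Kerr/flat window deviation functional
  `kerrDev 𝓢 q R ∈ [0, ∞]` through which the whole line is phrased (inf over `0 ≤ M`, `|a| ≤ M`, anchors `x₀ ∈ {r > r₊}` and
  anchored window charts of the `C²` sup norm of `Ψ^* g − g_{M,a}` on `B_R(x₀) ∩ {r > r₊}`; known harmless degeneracy:
  `R ≤ 0 ⇒` empty window `⇒ 0`);
* `IsFutureEscapingPath` (+ `IsFutureEscaping.comp_tendsto`, `IsFutureEscapingPath.seq`) — late observers.

Everything is a definition over EXISTING Literature declarations (`Kerr.exterior/background/radius`, `supCkENorm`,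
`Spacetime.deviationExtend`, `Spacetime.minkowskiDeviation`, `Spacetime.docOfEnd` via `EndDatum.doc`); nothing restates a route
item (the stubs stay in the crux workfile until proved). Docstrings are the planner's, verbatim.
-/

noncomputable section

-- the operator-norm instance on `E4 →L[ℝ] E4 →L[ℝ] ℝ` needs one more level of pending
-- instance problems than the default (as in `BoundedGeometry.lean` / `TameHullDefs`)
set_option maxSynthPendingDepth 3
-- every `Summit.FinalStateConjecture.FinalStateConjecture.…` name repeats the summit = sub-problem segment (D-0017 layout)
set_option linter.dupNamespace false

open Set Filter Function TopologicalSpace Manifold Bundle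
open scoped Topology Manifold ContDiff ENNReal NNReal

universe u


namespace Summit.FinalStateConjecture.FinalStateConjecture.Theorems.TameHull

open Literature.Geometry.Lorentzian

/-! ### Silent ends, global closeness, anchored Kerr windows and the window-deviation functional `kerrDev`,
future-escaping paths (skeleton §1b, verbatim) -/

namespace EndDatum

variable {𝓢 : Spacetime.{0} 4}

/-- **Silent end** (the output of the two monotone budgets on a hull element, old stub B's
conclusion bundled): two-sided non-radiating at order `1/r`, non-expanding shear-free horizon,
and the zeroth-law dichotomy red-shifted (`κ ≥ κ₀ > 0` for the adapted clock) or cold. [cite: ChruscielEtAl2001, Thm 1.1] -/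
def IsSilent (E : EndDatum 𝓢) : Prop :=
  E.IsNonRadiating ∧ E.IsSilentHorizon ∧ ((∃ κ₀ : ℝ, 0 < κ₀ ∧ E.IsRedShifted κ₀) ∨ E.IsColdHorizon)

/-- **Global `δ`-closeness of the end to Kerr `(M, a)`** (the GLOBAL topology of triage r1-3
sharpen (2)): ONE injective smooth map of the whole Kerr exterior `{r > r₊}` (ingoing Kerr–Schild
chart, all `t* ∈ ℝ`) onto the domain of outer communications, time-oriented outside the
ergoregion, along which the `C²` sup norm over the WHOLE exterior of `Ψ^* g − g_{M,a}` is `≤ δ`.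
`δ = 0` is `IsKerrDoc` up to the vanishing of a sup norm. [cite: DafermosLuk2017, Conjecture 1] -/
def IsGloballyClose (E : EndDatum 𝓢) (M a : ℝ) (δ : ℝ≥0∞) : Prop :=
  ∃ Ψ : Kerr.exterior M a → 𝓢.carrier, Function.Injective Ψ ∧ ContMDiff 𝓘(ℝ, E4) (𝓡 4) ∞ Ψ ∧
    Set.range Ψ = E.doc ∧
      supCkENorm (Kerr.exterior M a : Set E4) 2 (𝓢.deviationExtend (Kerr.background M a) Ψ) ≤ δ ∧
        ∀ x : Kerr.exterior M a, 2 * M < Kerr.radius a x.1 →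
          𝓢.timeOrientation.IsFutureDirected (mfderiv 𝓘(ℝ, E4) (𝓡 4) Ψ x (E4.basisVector 0))

/-- **Global `δ`-flatness of the end**: one injective smooth time-oriented map of `E4` onto the
domain of outer communications with `sup_{C²} ‖Ψ^* g − η‖ ≤ δ` on all of `E4`. [cite: ChristodoulouKlainerman1993, Thm. 1.0.2] -/
def IsGloballyFlat (E : EndDatum 𝓢) (δ : ℝ≥0∞) : Prop :=
  ∃ Ψ : E4 → 𝓢.carrier, Function.Injective Ψ ∧ ContMDiff 𝓘(ℝ, E4) (𝓡 4) ∞ Ψ ∧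
    Set.range Ψ = E.doc ∧ supCkENorm (Set.univ : Set E4) 2 (𝓢.minkowskiDeviation Ψ) ≤ δ ∧
      ∀ x : E4, 𝓢.timeOrientation.IsFutureDirected (mfderiv 𝓘(ℝ, E4) (𝓡 4) Ψ x (E4.basisVector 0))

end EndDatum

section Window

variable (𝓢 : Spacetime.{u} 4)

/-- The **Kerr window** of Euclidean radius `R` about the anchor `x₀` inside the exterior
`{r > r₊}` of Kerr `(M, a)` in ingoing Kerr–Schild Cartesian coordinates: `B_R(x₀) ∩ {r > r₊}`
(for `M = a = 0`: a Euclidean ball of flat `E4` punctured along the spatial origin line). [cite: arXiv210408222, §1] -/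
def kerrWindow (M a : ℝ) (x₀ : Kerr.exterior M a) (R : ℝ) : Set (Kerr.exterior M a) :=
  {x | dist x.1 x₀.1 < R}

/-- **Anchored window chart** at the point `q ∈ 𝓢`: a map `Ψ` of the Kerr exterior (only its
values on the window matter) with `Ψ x₀ = q`, smooth and injective on the window, and mapping the
Kerr–Schild time vector `∂_{t*}` to a future-directed vector wherever `∂_{t*}` is timelike in Kerr
(`r > 2M`, outside the ergoregion) — the black-hole, not the white-hole, orientation. [cite: arXiv210408222, §1] -/
structure IsWindowChart (M a : ℝ) (x₀ : Kerr.exterior M a) (R : ℝ) (q : 𝓢.carrier)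
    (Ψ : Kerr.exterior M a → 𝓢.carrier) : Prop where
  /-- The anchor is mapped to `q`. -/
  anchor : Ψ x₀ = q
  /-- `Ψ` is smooth on the window. -/
  contMDiffOn : ContMDiffOn 𝓘(ℝ, E4) (𝓡 4) ∞ Ψ (kerrWindow M a x₀ R)
  /-- `Ψ` is injective on the window. -/
  injOn : Set.InjOn Ψ (kerrWindow M a x₀ R)
  /-- `Ψ_* ∂_{t*}` is future-directed on the window outside the ergoregion. -/
  future : ∀ x ∈ kerrWindow M a x₀ R, 2 * M < Kerr.radius a x.1 →
    𝓢.timeOrientation.IsFutureDirected (mfderiv 𝓘(ℝ, E4) (𝓡 4) Ψ x (E4.basisVector 0))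

/-- **Anchored window deviation at fixed parameters**: the infimum over anchors `x₀ ∈ {r > r₊}`
and anchored window charts `Ψ` at `q` of the `C²` sup norm of `Ψ^* g − g_{M,a}` over the window
`B_R(x₀) ∩ {r > r₊}` (`⊤` if no chart exists). [cite: arXiv210408222, §1] -/
def anchoredDev (q : 𝓢.carrier) (M a R : ℝ) : ℝ≥0∞ :=
  ⨅ (x₀ : Kerr.exterior M a) (Ψ : Kerr.exterior M a → 𝓢.carrier) (_ : IsWindowChart 𝓢 M a x₀ R q Ψ),
    supCkENorm (Subtype.val '' kerrWindow M a x₀ R) 2 (𝓢.deviationExtend (Kerr.background M a) Ψ)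

/-- **The anchored Kerr window deviation `kerrDev 𝓢 q R`** — how far the pointed spacetime
`(𝓢, q)` is, at Euclidean scale `R`, from SOME pointed Kerr or flat window: the infimum of
`anchoredDev` over all parameters `0 ≤ M`, `|a| ≤ M` (extremal and `M = 0` = Minkowski included;
boosts/translations of the model are absorbed by the freedom of `Ψ`, so unboosted Kerr suffices).
`kerrDev = 0` on every scale at every point of the closed d.o.c. of an exact Kerr d.o.c. or of
Minkowski space (translate the isometric chart; S2 records it). Known harmless degeneracy: for
`R ≤ 0` the window is empty and `kerrDev = 0` (every statement below is trivial at such scales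
and the bridge S3 chooses its own scale). For `R > 0` there is no junk: the `C²` deviation AT THE
ANCHOR is bounded below by the distance of the curvature of `g` at `q` from the (type D) Kerr
curvatures, independently of `R` and of the chart (Lorentz frames are absorbed). The whole line
is phrased through this one functional. [cite: DafermosLuk2017, Conjecture 1] -/
def kerrDev (q : 𝓢.carrier) (R : ℝ) : ℝ≥0∞ :=
  ⨅ (M : ℝ) (a : ℝ) (_ : 0 ≤ M ∧ |a| ≤ M), anchoredDev 𝓢 q M a R

end Window

section Paths

variable {X : Type} [TopologicalSpace X] [ChartedSpace E3 X] [IsManifold (𝓡 3) ∞ X]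
  [T2Space X] [SecondCountableTopology X] [ConnectedSpace X] {D : InitialDataSet (𝓡 3) X}

/-- A **future-escaping outer path**: a curve of OUTER points which eventually leaves the causal
past of every compact set (a late observer; the base paths of based hulls). [folklore] -/
def IsFutureEscapingPath (𝒟 : VacuumCauchyDevelopment D) [𝒟.metric.HasLeviCivita]
    (γ : ℝ → 𝒟.carrier) : Prop :=
  (∀ s, γ s ∈ outerRegion 𝒟) ∧
    ∀ K : Set 𝒟.carrier, IsCompact K →
      ∀ᶠ s in atTop, γ s ∉ 𝒟.metric.causalPast 𝒟.timeOrientation K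

variable {𝒟 : VacuumCauchyDevelopment D} [𝒟.metric.HasLeviCivita]

omit [T2Space X] [SecondCountableTopology X] in
/-- Subsequences of future-escaping sequences are future-escaping. [folklore] -/
theorem IsFutureEscaping.comp_tendsto {q : ℕ → 𝒟.carrier} (hq : IsFutureEscaping 𝒟 q)
    {φ : ℕ → ℕ} (hφ : Tendsto φ atTop atTop) : IsFutureEscaping 𝒟 (q ∘ φ) :=
  ⟨fun n ↦ hq.1 (φ n), fun K hK ↦ hφ.eventually (hq.2 K hK)⟩

omit [T2Space X] [SecondCountableTopology X] in
/-- Sampling a future-escaping path at times `sₙ → ∞` gives a future-escaping sequence. [folklore] -/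
theorem IsFutureEscapingPath.seq {γ : ℝ → 𝒟.carrier} (hγ : IsFutureEscapingPath 𝒟 γ)
    {s : ℕ → ℝ} (hs : Tendsto s atTop atTop) : IsFutureEscaping 𝒟 (fun n ↦ γ (s n)) :=
  ⟨fun n ↦ hγ.1 (s n), fun K hK ↦ hs.eventually (hγ.2 K hK)⟩

end Paths

/-! ### API (registered sub-goal `kerrDev_le_anchoredDev` of stmt-FinalStateConjecture-14075: the projection that lets stub
files bound the functional by exhibiting ONE admissible parameter pair, anchor and chart) -/

/-- `kerrDev` is bounded by the anchored deviation at every admissible parameter pair `0 ≤ M`, `|a| ≤ M` (projection of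
the infimum). [folklore] -/
theorem kerrDev_le_anchoredDev : ∀ {𝓢 : Spacetime.{0} 4} (q : 𝓢.carrier) (M a R : ℝ), 0 ≤ M → |a| ≤ M → kerrDev 𝓢 q R ≤ anchoredDev 𝓢 q M a R :=
  fun _ M a _ hM ha ↦ iInf_le_of_le M <| iInf_le_of_le a <| iInf_le _ (show 0 ≤ M ∧ |a| ≤ M from ⟨hM, ha⟩)


end Summit.FinalStateConjecture.FinalStateConjecture.Theorems.TameHull

end
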